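import Literature.NumberTheory.EllipticCurves.EisensteinNewformLevelRaisingOrdinaryProofs
import Literature.NumberTheory.EllipticCurves.NewformsProofs
import Literature.AlgebraicGeometry.Motives.FaltingsECEndCoreOrdinaryProofs
import HarnessLib

/-!
# Determinants on inertia away from `p` are trivial: the newform side and the Tate-module side (brick LM-E of
# `stub_levelMatch_ns`)

Route `SignedLowerHalves`, child L `SmallImageLowerHalfBothSigns` (item stmt-BirchSwinnertonDyer-23599), line `rtt_w3`
(v2, REGISTERED 2026-08-29T19:01:30Z; stub `stub_levelMatch_ns`; width seat `bsd-line-slh-p3-w3` gen 10; memo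
`Lines/birth_acns-MEMO-w3-g10.md` §4).  THEOREMS ONLY (no definition, no named fact, no `sorry`); ROUTE-INDEPENDENT.

The dichotomy brick LM-B (`…LevelMatchDichotomy`) asks that the determinant be trivial on the subgroup.  For the two
representations compared by the level clause this holds on every inertia group at a prime `𝔓 ∤ p`:

* `nebentypusCoeff_liftToGamma1_coe_units` — the `Γ₁(M)`-lift of a non-zero `Γ₀(M)`-form has trivial nebentypus, so
  its coefficient-field nebentypus values at units are `1`;
* `cyclotomicCharacter_rat_eq_one_of_mem_inertia` — `ε_p(σ) = 1` for `σ ∈ I_𝔓`, `𝔓 ∣ v ∤ p`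
  (`FramedGaloisRep.isUnramifiedAt_cyclotomic_holds`);
* **`det_eq_one_of_mem_inertia_of_isGaloisRepOfNewform1_liftToGamma1`** — for `ρ : Γ_ℚ → GL₂(ℚ̄_p)` attached to the
  lift of a `Γ₀(M)`-form of weight `2` (`IsGaloisRepOfNewform1`), `det ρ(σ) = 1` on `I_𝔓`, `𝔓 ∤ p`
  (`det ρ = ε·χ_p^{k−1}`, `det_eq_of_isGaloisRepOfNewform1_padicAlgCl`, Ribet 1977 Prop. 2.2);
* **`det_rationalGaloisRepTate_eq_one_of_mem_inertia`** — for an elliptic curve `W/K`, `det V_p(W)(σ) = 1` on `I_𝔓`,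
  `𝔓 ∤ p` (`det = χ_p`, Silverman AEC III.8.3, `det_rationalGaloisRepTate_eq_cyclotomicCharacter`).

BSD, crux L and the stub are NOT proved here.

References: K. Ribet, LNM 601 (1977) Prop. (2.2); J. Silverman, AEC III.8.3; J.-P. Serre, Abelian ℓ-adic representations
I §1.2.
-/

set_option autoImplicit false
set_option linter.dupNamespace false

noncomputable section

open scoped MatrixGroups NumberField ModularForm
open CongruenceSubgroup IsDedekindDomain Field NumberField

namespace Summit.BirchSwinnertonDyer.BirchSwinnertonDyer.Theorems.SmallImageLambdaLowerThreeNsThetaPartner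

open Literature.NumberTheory.GaloisRepresentations Literature.NumberTheory.EllipticCurves
  Literature.NumberTheory.EllipticCurves.ModularForms

/-- `ε_p(σ) = 1` for `σ` in an inertia group at a prime `𝔓 ∣ v` with `v ∤ p` (number field `K`; the discharged
`FramedGaloisRep.isUnramifiedAt_cyclotomic_holds` read through `FramedGaloisRep.det_cyclotomic_apply`).
[cite: SerreAbelianLadic1968, Ch. I §1.2 (Example: the cyclotomic character)] -/
theorem cyclotomicCharacter_eq_one_of_mem_inertia' {K : Type} [Field K] [NumberField K] (p : ℕ) [Fact p.Prime]
    {v : HeightOneSpectrum (𝓞 K)} (hv : ((p : ℕ) : 𝓞 K) ∉ v.asIdeal) {𝔓 : Ideal (absIntegers (𝓞 K) K)}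
    (h𝔓 : 𝔓 ∈ v.primesAbove) {σ : absoluteGaloisGroup K} (hσ : σ ∈ 𝔓.inertia (absoluteGaloisGroup K)) :
    GaloisRep.cyclotomicCharacter K p σ = 1 := by
  have h1 : (FramedGaloisRep.cyclotomic K p) σ = 1 := FramedGaloisRep.isUnramifiedAt_cyclotomic_holds K p hv 𝔓 h𝔓 σ hσ
  rw [← FramedGaloisRep.det_cyclotomic_apply]
  change Matrix.GeneralLinearGroup.det ((FramedGaloisRep.cyclotomic K p) σ) = 1
  rw [h1, map_one]

/-- The nebentypus values (in the coefficient field with character values) of the `Γ₁(M)`-lift of a non-zero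
`Γ₀(M)`-form at units are `1` (trivial nebentypus, `nebentypus_liftToGamma1_holds`).
[cite: DiamondShurman2005, §4.3 (S_k(Γ₀(N)) = S_k(N, 𝟙))] -/
theorem nebentypusCoeff_liftToGamma1_coe_units {M : ℕ} [NeZero M] {k : ℤ} {g : CuspForm (Gamma0 M) k} (hg0 : g ≠ 0)
    (u : (ZMod M)ˣ) : nebentypusCoeff (liftToGamma1 M k g) (u : ZMod M) = 1 := by
  apply Subtype.ext
  change nebentypus (liftToGamma1 M k g) (u : ZMod M) = 1
  rw [nebentypus_liftToGamma1_holds M k hg0, MulChar.one_apply_coe]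

/-- **Newform side: `det ρ_g = 1` on inertia away from `p`.**  For a non-zero `g ∈ S₂(Γ₀(M))`, `ρ : Γ_ℚ → GL₂(ℚ̄_p)`
attached to its `Γ₁(M)`-lift away from `M p` along `ι` (`IsGaloisRepOfNewform1`), a place `v ∤ p` of `ℚ`, a prime
`𝔓 ∣ v` of `\bar ℤ` and `σ ∈ I_𝔓`: `det ρ(σ) = 1` (`det ρ = ε(χ_M)·χ_p`, trivial nebentypus, `χ_p` unramified at `v`).
[cite: Ribet1977Nebentypus, Prop. (2.2)] -/
theorem det_eq_one_of_mem_inertia_of_isGaloisRepOfNewform1_liftToGamma1 {M : ℕ} [NeZero M]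
    {g : CuspForm (Gamma0 M) 2} (hg0 : g ≠ 0) {p : ℕ} [Fact p.Prime]
    {ι : coeffCharField (liftToGamma1 M 2 g) →+* PadicAlgCl p} {ρ : FramedGaloisRep ℚ (PadicAlgCl p) 2}
    (hρ : IsGaloisRepOfNewform1 (liftToGamma1 M 2 g) ι {q | q ∣ M * p} ρ)
    {v : HeightOneSpectrum (𝓞 ℚ)} (hv : ((p : ℕ) : 𝓞 ℚ) ∉ v.asIdeal) {𝔓 : Ideal (absIntegers (𝓞 ℚ) ℚ)}
    (h𝔓 : 𝔓 ∈ v.primesAbove) {σ : absoluteGaloisGroup ℚ} (hσ : σ ∈ 𝔓.inertia (absoluteGaloisGroup ℚ)) :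
    Matrix.GeneralLinearGroup.det (ρ σ) = 1 := by
  have hdet := det_eq_of_isGaloisRepOfNewform1_padicAlgCl hρ (m := 1) (by norm_num) σ
  rw [nebentypusCoeff_liftToGamma1_coe_units hg0, map_one, one_mul, pow_one,
    cyclotomicCharacter_eq_one_of_mem_inertia' p hv h𝔓 hσ, Units.val_one, PadicInt.coe_one, map_one] at hdet
  exact Units.ext (by rw [Matrix.GeneralLinearGroup.val_det_apply, hdet, Units.val_one])

/-- **Tate-module side: `det V_p(W) = 1` on inertia away from `p`.**  For an elliptic curve `W` over a number field
`K`, a place `v ∤ p`, a prime `𝔓 ∣ v` and `τ ∈ I_𝔓`: the determinant of `τ` on `V_p(W)` is `1` (`det = χ_p`).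
[cite: SilvermanAEC2009, Prop. III.8.3] -/
theorem det_rationalGaloisRepTate_eq_one_of_mem_inertia {K : Type} [Field K] [NumberField K] (W : WeierstrassCurve K)
    [W.IsElliptic] (p : ℕ) [Fact p.Prime] {v : HeightOneSpectrum (𝓞 K)} (hv : ((p : ℕ) : 𝓞 K) ∉ v.asIdeal)
    {𝔓 : Ideal (absIntegers (𝓞 K) K)} (h𝔓 : 𝔓 ∈ v.primesAbove) {τ : absoluteGaloisGroup K}
    (hτ : τ ∈ 𝔓.inertia (absoluteGaloisGroup K)) :
    LinearMap.det (WeierstrassCurve.rationalGaloisRepTate W p τ :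
      W.rationalTateModule p →ₗ[ℚ_[p]] W.rationalTateModule p) = 1 := by
  rw [Literature.AlgebraicGeometry.Motives.det_rationalGaloisRepTate_eq_cyclotomicCharacter W p τ,
    cyclotomicCharacter_eq_one_of_mem_inertia' p hv h𝔓 hτ, Units.val_one, map_one]

end Summit.BirchSwinnertonDyer.BirchSwinnertonDyer.Theorems.SmallImageLambdaLowerThreeNsThetaPartner

end
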